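import Summits.ValiantsHypothesis.ValiantsHypothesis.Theorems.PolyaContinuedMonotoneCoverHardIdleSplitCard

/-!
# Crux `MonotoneCoverHard` (stmt-ValiantsHypothesis-7421), width line — **FIBER SPREAD**: a `T`-fiber
spreads its `T`-labels over at least `#T² / 2` rows

(val-width-7421-p4 g0, 2026-08-28; lane «width ≥ 3 at one level ⇒ non-Pfaffian».)

* `sq_le_two_mul_card_fiberRows` — (local Mignon–Ressayre) for every weight-nonzero perfect matching
  `τ₀` (label permutation `σ₀`) of a label-bijective Pfaffian cover of `per_n` and every set `T` of
  `≥ 3` label-rows, the `T`-FIBER of `τ₀` — the `#T!` weight-nonzero perfect matchings carrying the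
  labels `x_{k σ₀ k}`, `k ∉ T` — carries its `T`-labels on at least `#T² / 2` distinct rows.  Proof:
  fiber substitution (`aeval_fiberSubst_perPoly`) + the quantitative idle-split engine
  (`sq_le_two_mul_card_of_idleSplit`) with `U` = rows never carrying a `T`-label in the fiber, `P = ∅`.
  `T` = all label-rows is val-width-7421-p3's `sq_le_two_mul_card_activeRows`; the equality case
  "the `T`-labels stay on `#T` rows" is `false_of_fiber_lanes`.

Reading for `stub_width`: a wide level cannot be served by few rows even locally — every `t`-sub-fiber
of every matching must ROTATE its `t` tokens through `≥ t²/2` rows.  VP ≠ VNP is not moved;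
`MonotoneCoverHard` stays open.  No definitions.
-/

namespace Summit.ValiantsHypothesis.ValiantsHypothesis.Theorems.PolyaContinuedMonotoneCoverHard

-- summit = sub-problem name (single-conjunct summit, D-0017 layout), so the namespace repeats it
set_option linter.dupNamespace false

open scoped Classical
open Finset
open Literature.Combinatorics.SimpleGraph (IsPolyaSigning)
open Literature.Computability.AlgebraicComplexity (perPoly HasDetRepr sq_le_two_mul_of_hasDetRepr_perPoly)

/-- **Fiber spread.**  For a weight-nonzero perfect matching `τ₀` with label permutation `σ₀` of a
label-bijective Pfaffian cover of `per_n` and a set `T` of at least three label-rows, the rows carrying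
a label with label-row in `T` in some weight-nonzero perfect matching of the `T`-fiber of `τ₀` (the
matchings carrying `x_{k σ₀ k}` for all `k ∉ T`) number at least `#T² / 2`. -/
theorem sq_le_two_mul_card_fiberRows (n m : ℕ) (E : Finset (Fin m × Fin m))
    (a : Fin m × Fin m → MvPolynomial (Fin n × Fin n) ℂ)
    (hsig : ∃ s : Fin m × Fin m → ℂ, (∀ e, s e = 1 ∨ s e = -1) ∧
      (Matrix.of fun i j => if (i, j) ∈ E then MvPolynomial.C (s (i, j)) * MvPolynomial.X (i, j)
          else 0 : Matrix (Fin m) (Fin m) (MvPolynomial (Fin m × Fin m) ℂ)).det =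
        (Matrix.of fun i j => if (i, j) ∈ E then MvPolynomial.X (i, j) else 0 :
          Matrix (Fin m) (Fin m) (MvPolynomial (Fin m × Fin m) ℂ)).permanent)
    (ha : ∀ e, (∃ j, a e = MvPolynomial.X j) ∨ a e = 0 ∨ a e = 1)
    (hper : perPoly (Fin n) ℂ =
      MvPolynomial.aeval a (Matrix.of fun i j => if (i, j) ∈ E then MvPolynomial.X (i, j) else 0 :
          Matrix (Fin m) (Fin m) (MvPolynomial (Fin m × Fin m) ℂ)).permanent)
    (τ₀ : Equiv.Perm (Fin m)) (hτ₀ : ∀ i, (i, τ₀ i) ∈ E ∧ a (i, τ₀ i) ≠ 0)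
    (σ₀ : Equiv.Perm (Fin n)) (hσ₀ : ∀ i j, a (i, τ₀ i) = MvPolynomial.X j → σ₀ j.1 = j.2)
    (T : Finset (Fin n)) (hK3 : 3 ≤ T.card) :
    T.card ^ 2 ≤ 2 * (univ.filter fun i : Fin m => ∃ τ : Equiv.Perm (Fin m),
      (∀ i, (i, τ i) ∈ E ∧ a (i, τ i) ≠ 0) ∧ (∀ k, k ∉ T → ∃ i, a (i, τ i) = MvPolynomial.X (k, σ₀ k)) ∧
      ∃ v : Fin n × Fin n, a (i, τ i) = MvPolynomial.X v ∧ v.1 ∈ T).card := by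
  set f : Fin n × Fin n → MvPolynomial (Fin T.card × Fin T.card) ℂ := fun v =>
    if hk : v.1 ∈ T then
      (if hl : σ₀.symm v.2 ∈ T then
        (MvPolynomial.X (T.equivFin ⟨v.1, hk⟩, T.equivFin ⟨σ₀.symm v.2, hl⟩) :
          MvPolynomial (Fin T.card × Fin T.card) ℂ)
      else 0)
    else if v.2 = σ₀ v.1 then 1 else 0 with hf
  set a' : Fin m × Fin m → MvPolynomial (Fin T.card × Fin T.card) ℂ :=
    fun e => MvPolynomial.aeval f (a e) with ha'def
  have ha'ap : ∀ e, a' e = MvPolynomial.aeval f (a e) := fun e => rfl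
  have hX0 : ∀ j, (MvPolynomial.X j : MvPolynomial (Fin T.card × Fin T.card) ℂ) ≠ 0 :=
    fun j => MvPolynomial.X_ne_zero j
  have hX1 : ∀ j, (MvPolynomial.X j : MvPolynomial (Fin T.card × Fin T.card) ℂ) ≠ 1 := by
    intro j h
    have h1 := congrArg MvPolynomial.totalDegree h
    rw [MvPolynomial.totalDegree_X, MvPolynomial.totalDegree_one] at h1
    exact one_ne_zero h1
  -- the four values of `f`
  have hfX : ∀ v : Fin n × Fin n, ∀ (hk : v.1 ∈ T) (hl : σ₀.symm v.2 ∈ T),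
      f v = MvPolynomial.X (T.equivFin ⟨v.1, hk⟩, T.equivFin ⟨σ₀.symm v.2, hl⟩) := by
    intro v hk hl
    rw [hf]
    simp only
    rw [dif_pos hk, dif_pos hl]
  have hf0 : ∀ v : Fin n × Fin n, v.1 ∈ T → σ₀.symm v.2 ∉ T → f v = 0 := by
    intro v hk hl
    rw [hf]
    simp only
    rw [dif_pos hk, dif_neg hl]
  have hf1 : ∀ v : Fin n × Fin n, v.1 ∉ T → v.2 = σ₀ v.1 → f v = 1 := by
    intro v hk hl
    rw [hf]
    simp only
    rw [dif_neg hk, if_pos hl]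
  have hf0' : ∀ v : Fin n × Fin n, v.1 ∉ T → v.2 ≠ σ₀ v.1 → f v = 0 := by
    intro v hk hl
    rw [hf]
    simp only
    rw [dif_neg hk, if_neg hl]
  have ha'X : ∀ e v, a e = MvPolynomial.X v → a' e = f v := by
    intro e v hv
    rw [ha'ap, hv, MvPolynomial.aeval_X]
  -- label shape of the substituted cover
  have ha' : ∀ e, (∃ j, a' e = MvPolynomial.X j) ∨ a' e = 0 ∨ a' e = 1 := by
    intro e
    rcases ha e with ⟨v, hv⟩ | h | h
    · rw [ha'X e v hv]
      by_cases hk : v.1 ∈ T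
      · by_cases hl : σ₀.symm v.2 ∈ T
        · exact Or.inl ⟨_, hfX v hk hl⟩
        · exact Or.inr (Or.inl (hf0 v hk hl))
      · by_cases hl : v.2 = σ₀ v.1
        · exact Or.inr (Or.inr (hf1 v hk hl))
        · exact Or.inr (Or.inl (hf0' v hk hl))
    · right; left
      rw [ha'ap, h, map_zero]
    · right; right
      rw [ha'ap, h, map_one]
  -- F1: a new variable label comes from an old variable label with label-row in `K`
  have hF1 : ∀ e j', a' e = MvPolynomial.X j' → ∃ v, a e = MvPolynomial.X v ∧ v.1 ∈ T := by
    intro e j' h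
    rcases ha e with ⟨v, hv⟩ | h0 | h1
    · refine ⟨v, hv, ?_⟩
      by_contra hk
      rw [ha'X e v hv] at h
      by_cases hl : v.2 = σ₀ v.1
      · rw [hf1 v hk hl] at h
        exact hX1 j' h.symm
      · rw [hf0' v hk hl] at h
        exact hX0 j' h.symm
    · exfalso
      rw [ha'ap, h0, map_zero] at h
      exact hX0 j' h.symm
    · exfalso
      rw [ha'ap, h1, map_one] at h
      exact hX1 j' h.symm
  -- F2: new-nonzero labels are old-nonzero
  have hF2 : ∀ e, a' e ≠ 0 → a e ≠ 0 := by
    intro e h h0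
    apply h
    rw [ha'ap, h0, map_zero]
  -- F3: a new-good matching is old-good and carries the labels `x_{k σ₀ k}`, `k ∉ T`
  have hF3 : ∀ τ : Equiv.Perm (Fin m), (∀ i, (i, τ i) ∈ E ∧ a' (i, τ i) ≠ 0) →
      (∀ i, (i, τ i) ∈ E ∧ a (i, τ i) ≠ 0) ∧
      (∀ k, k ∉ T → ∃ i, a (i, τ i) = MvPolynomial.X (k, σ₀ k)) := by
    intro τ hτ
    have hτold : ∀ i, (i, τ i) ∈ E ∧ a (i, τ i) ≠ 0 := fun i => ⟨(hτ i).1, hF2 _ (hτ i).2⟩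
    refine ⟨hτold, fun k hk => ?_⟩
    obtain ⟨σ, -, hσ2⟩ := exists_perm_labels E a ha hper τ hτold
    obtain ⟨i, hi, -⟩ := hσ2 k
    have hne := (hτ i).2
    rw [ha'X _ _ hi] at hne
    by_cases hl : σ k = σ₀ k
    · exact ⟨i, by rw [hi, hl]⟩
    · exact absurd (hf0' (k, σ k) hk hl) hne
  -- F5: `τ₀` is a weight-nonzero perfect matching of the substituted cover
  have hτ₀' : ∀ i, (i, τ₀ i) ∈ E ∧ a' (i, τ₀ i) ≠ 0 := by
    intro i
    refine ⟨(hτ₀ i).1, ?_⟩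
    rcases ha (i, τ₀ i) with ⟨v, hv⟩ | h0 | h1
    · have hv2 : v.2 = σ₀ v.1 := (hσ₀ i v hv).symm
      rw [ha'X _ _ hv]
      by_cases hk : v.1 ∈ T
      · have hl : σ₀.symm v.2 ∈ T := by rw [hv2, Equiv.symm_apply_apply]; exact hk
        rw [hfX v hk hl]
        exact hX0 _
      · rw [hf1 v hk hv2]
        exact one_ne_zero
    · exact absurd h0 (hτ₀ i).2
    · rw [ha'ap, h1, map_one]
      exact one_ne_zero
  -- the substituted cover computes `per_{#T}`
  have hper' : perPoly (Fin T.card) ℂ =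
      MvPolynomial.aeval a' (Matrix.of fun i j => if (i, j) ∈ E then MvPolynomial.X (i, j) else 0 :
          Matrix (Fin m) (Fin m) (MvPolynomial (Fin m × Fin m) ℂ)).permanent := by
    rw [← aeval_fiberSubst_perPoly T σ₀, hper, MvPolynomial.comp_aeval_apply]
  -- quantitative engine with `U` = rows never carrying a `T`-label in the fiber, `P = ∅`
  have h := sq_le_two_mul_card_of_idleSplit T.card m hK3 E a' hsig ha' hper' τ₀ hτ₀'
    (fun i => ¬ ∃ τ : Equiv.Perm (Fin m), (∀ i, (i, τ i) ∈ E ∧ a (i, τ i) ≠ 0) ∧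
      (∀ k, k ∉ T → ∃ i, a (i, τ i) = MvPolynomial.X (k, σ₀ k)) ∧
      ∃ v : Fin n × Fin n, a (i, τ i) = MvPolynomial.X v ∧ v.1 ∈ T)
    (fun _ => False) ?_ ?_ ?_ ?_ ?_
  · refine h.trans (Nat.mul_le_mul_left 2 (le_of_eq ?_))
    rw [Fintype.card_subtype]
    refine congrArg Finset.card (Finset.filter_congr fun i _ => ?_)
    simp only [not_not, not_false_eq_true, and_true]
  · -- rows outside the spread have non-variable `τ₀`-edges
    intro i hU hv
    obtain ⟨k', hk'⟩ := hv
    obtain ⟨v, hv, hvT⟩ := hF1 _ _ hk'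
    obtain ⟨hτold, hagree⟩ := hF3 τ₀ hτ₀'
    exact hU ⟨τ₀, hτold, hagree, v, hv, hvT⟩
  · intro i hP; exact hP.elim
  · -- rows outside the spread emit no used variable edge
    rintro i j hU ⟨τ, hτ, rfl⟩ ⟨k', hk'⟩
    obtain ⟨hτold, hagree⟩ := hF3 τ hτ
    obtain ⟨v, hv, hvT⟩ := hF1 _ _ hk'
    exact hU ⟨τ, hτold, hagree, v, hv, hvT⟩
  · intro i i' _ hP; exact hP.elim
  · intro i i' _ hP; exact hP.elim

end Summit.ValiantsHypothesis.ValiantsHypothesis.Theorems.PolyaContinuedMonotoneCoverHard
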